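import Summits.AtomisticToContinuum.HydrodynamicLimit.Theorems.InformationPercolationEngineChaosClosesEulerReductionEntropyA
import Summits.AtomisticToContinuum.HydrodynamicLimit.Theorems.InformationPercolationEngineChaosClosesEulerReductionEvents
import HarnessLib

/-!
# Kinetic reduction (crux `ChaosClosesEuler`, stmt-AtomisticToContinuum-15141, line `Sketch`,
# stub `stub_kineticReduction`) — helper: the entropy hypothesis (H3) along one orbit, pathwise

WHAT. THE PATHWISE STEP OF (H3). Along ONE good orbit under the density cap on `[0, t_sh]`, the shell's entropy
functional of the window starting at `τ₀ ∈ [0, t_sh − Δ]` is bounded by the clamped local second law functional at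
the grid window start `τ₀_g ≤ τ₀ ≤ τ₀_g + h₀` (test `ramp·θ(·+e)·cut(τ₀_g, ·)`, horizon `τ_L ≥ t_sh`), plus a
Lipschitz-in-`τ₀` error of order `h₀` and a shift error of order the moduli of `θ, ∂ₜθ, ∇θ` under the shift `e`
(`entropy_pathwise`). Ingredients: the two clamped weights agree against `ρ_r, m_r` under the cap (helper
`ReductionEntropyPoint`), kinetic domination of entropy integrands (helper `ReductionEntropyA`), the product rule for
the tests, and `∫ρ_r = 1`.

No named fact is invoked.
-/

noncomputable section

namespace Summit.AtomisticToContinuum.HydrodynamicLimit.Theorems.ChaosClosesEulerReduction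

open scoped BigOperators Topology Classical MeasureTheory InnerProductSpace
open Filter Set MeasureTheory Function
open Literature.MathematicalPhysics.KineticTheory
open Literature.Analysis.FluidPDE
open Literature.Analysis.FunctionSpaces
open Summit.AtomisticToContinuum.HydrodynamicLimit.Theorems.LocalSecondLawNegative
open Summit.AtomisticToContinuum.HydrodynamicLimit.Theorems.LocalSecondLawLedger

variable {N : ℕ}

/-! ## §1 The initial term -/

/-- **The initial term against a bounded factor**: `|∫ ρ_r Z g| ≤ Z_m G` for `|Z| ≤ Z_m`, `|g| ≤ G`
(`∫ρ_r = 1`, `r < 1/2`). [folklore] -/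
theorem abs_integral_rho_weight_le {r : ℝ} (hr : 0 < r) (hr2 : r < 1 / 2) (w : Phase N) {Z g : T3 → ℝ}
    {Zm G : ℝ} (hZm : ∀ x, |Z x| ≤ Zm) (hG : ∀ x, |g x| ≤ G) :
    |∫ x, rhoC r w x * Z x * g x| ≤ Zm * G := by
  have hZ0 : 0 ≤ Zm := (abs_nonneg _).trans (hZm 0)
  have hG0 : 0 ≤ G := (abs_nonneg _).trans (hG 0)
  have hρi : Integrable (rhoC r w) volume := (continuous_rhoC r w).integrable_unitAddTorus
  have hpt : ∀ x, ‖rhoC r w x * Z x * g x‖ ≤ Zm * G * rhoC r w x := fun x => by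
    rw [Real.norm_eq_abs, abs_mul, abs_mul, abs_of_nonneg (rhoC_nonneg hr w x)]
    have := hZm x; have := hG x; have := rhoC_nonneg hr w x
    calc rhoC r w x * |Z x| * |g x| ≤ rhoC r w x * Zm * G := by gcongr
      _ = Zm * G * rhoC r w x := by ring
  calc |∫ x, rhoC r w x * Z x * g x| ≤ ∫ x, Zm * G * rhoC r w x := by
        rw [← Real.norm_eq_abs]
        exact norm_integral_le_of_norm_le (hρi.const_mul _) (ae_of_all _ hpt)
    _ = Zm * G := by rw [integral_const_mul, integral_rhoC_eq_one hr hr2, mul_one]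

/-! ## §2 The registered sub-goal: bookkeeping -/

/-- **Registered sub-goal `stub_reductionEntropy` (helper of `stub_kineticReduction`): the bookkeeping of (H3)** —
grid value plus Lipschitz error plus shift error. [folklore] -/
theorem stub_reductionEntropy : ∀ {H HL Hg Ig ηL E₁ E₂ : ℝ}, H = HL → |HL - Hg| ≤ E₁ → |Hg - Ig| ≤ E₂ → Ig ≤ ηL → H ≤ ηL + E₁ + E₂ := by
  intro H HL Hg Ig ηL E₁ E₂ h1 h2 h3 h4
  rw [h1]
  linarith [(abs_le.1 h2).2, (abs_le.1 h3).2]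

/-! ## §3 The pathwise step -/

set_option maxHeartbeats 1600000 in
/-- **THE PATHWISE STEP OF (H3).** See the module docstring. [folklore] -/
theorem entropy_pathwise {σ : ℝ} (hσ : 0 < σ) (Φ : HardSphereFlow (Torus.geometry (Fin 3)) (hsDiameter σ N) (N + 1))
    {z : Phase N} (hz : z ∈ Φ.good) {r : ℝ} (hr : 0 < r) (hr2 : r < 1 / 2)
    {T : ℝ} {θ : ℝ → T3 → ℝ} (hθ : Torus.IsSmoothSpaceTimeOn (Ico 0 T) θ)
    {e Δ tsh τL : ℝ} (he : 0 < e) (hΔ : 0 < Δ) (hΔt : Δ ≤ tsh) (htL : tsh ≤ τL) (hte : tsh + e < T)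
    {f : ℝ → ℝ} {η₁ a₁ b₁ : ℝ} (hfband : ∀ c, 0 < c → c * σ ^ 3 ≤ η₁ → f c = hsExcessFreeEnergy (c * σ ^ 3))
    (hcap : ∀ s ∈ Icc 0 tsh, ∀ x, rhoC r (Φ.flow s z) x * σ ^ 3 ≤ η₁)
    (hFc : ContinuousOn (fun c => hsExcessFreeEnergy (min c η₁) + deriv hsExcessFreeEnergy η₁ * max (c - η₁) 0) (Ici 0))
    {Cθ : ℝ} (hCθ : 0 ≤ Cθ) (hθb : ∀ s ∈ Icc 0 (tsh + e), ∀ x, |θ s x| ≤ Cθ)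
    (hθt : ∀ s ∈ Icc 0 (tsh + e), ∀ x, |Torus.timeDerivWithin (Ico 0 T) θ s x| ≤ Cθ)
    (hθx : ∀ s ∈ Icc 0 (tsh + e), ∀ x, ‖Torus.gradient (θ s) x‖ ≤ Cθ)
    {ω : ℝ} (hω : 0 ≤ ω) (hωθ : ∀ s ∈ Icc 0 tsh, ∀ x, |θ (s + e) x - θ s x| ≤ ω)
    (hωt : ∀ s ∈ Icc 0 tsh, ∀ x, |Torus.timeDerivWithin (Ico 0 T) θ (s + e) x - Torus.timeDerivWithin (Ico 0 T) θ s x| ≤ ω)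
    (hωx : ∀ s ∈ Icc 0 tsh, ∀ x, ‖Torus.gradient (θ (s + e)) x - Torus.gradient (θ s) x‖ ≤ ω)
    {C : ℝ} (hC1 : ∀ x, |deriv Real.smoothTransition x| ≤ C) (hC2 : ∀ x, |deriv (deriv Real.smoothTransition) x| ≤ C)
    {KE : ℝ} (hKE : ke z ≤ KE) {n : ℕ} (hn : 1 ≤ n) {ηL : ℝ}
    (hLg : ∀ g : Fin (n + 1), (∫ s in Icc 0 τL, ∫ x,
      (rhoC r (Φ.flow s z) x * max a₁ (min (3 / 2 * Real.log (thetaC r (Φ.flow s z) x) - Real.log (rhoC r (Φ.flow s z) x) -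
        (hsExcessFreeEnergy (min (rhoC r (Φ.flow s z) x * σ ^ 3) η₁) +
          deriv hsExcessFreeEnergy η₁ * max (rhoC r (Φ.flow s z) x * σ ^ 3 - η₁) 0)) b₁) *
        Torus.timeDeriv (fun s' y => Real.smoothTransition ((s' + e / 2) / (e / 4)) * θ (s' + e) y *
          Real.smoothTransition (((g : ℝ) * ((tsh - Δ) / n) + Δ - s') / Δ)) s x +
      max a₁ (min (3 / 2 * Real.log (thetaC r (Φ.flow s z) x) - Real.log (rhoC r (Φ.flow s z) x) -
        (hsExcessFreeEnergy (min (rhoC r (Φ.flow s z) x * σ ^ 3) η₁) +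
          deriv hsExcessFreeEnergy η₁ * max (rhoC r (Φ.flow s z) x * σ ^ 3 - η₁) 0)) b₁) *
        ⟪momC r (Φ.flow s z) x, Torus.gradient (fun y => Real.smoothTransition ((s + e / 2) / (e / 4)) * θ (s + e) y *
          Real.smoothTransition (((g : ℝ) * ((tsh - Δ) / n) + Δ - s) / Δ)) x⟫_ℝ)) +
      ∫ x, rhoC r (Φ.flow 0 z) x * max a₁ (min (3 / 2 * Real.log (thetaC r (Φ.flow 0 z) x) - Real.log (rhoC r (Φ.flow 0 z) x) -
        (hsExcessFreeEnergy (min (rhoC r (Φ.flow 0 z) x * σ ^ 3) η₁) +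
          deriv hsExcessFreeEnergy η₁ * max (rhoC r (Φ.flow 0 z) x * σ ^ 3 - η₁) 0)) b₁) *
        (Real.smoothTransition (((0 : ℝ) + e / 2) / (e / 4)) * θ (0 + e) x *
          Real.smoothTransition (((g : ℝ) * ((tsh - Δ) / n) + Δ - 0) / Δ)) ≤ ηL)
    {τ₀ : ℝ} (hτ₀ : τ₀ ∈ Icc 0 (tsh - Δ)) :
    (∫ s in Icc 0 tsh, ∫ x,
      (rhoC r (Φ.flow s z) x * max a₁ (min (3 / 2 * Real.log (thetaC r (Φ.flow s z) x) - Real.log (rhoC r (Φ.flow s z) x) -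
        f (rhoC r (Φ.flow s z) x)) b₁) *
        Torus.timeDerivWithin (Ico 0 T) (fun s' y => θ s' y * Real.smoothTransition ((τ₀ + Δ - s') / Δ)) s x +
      max a₁ (min (3 / 2 * Real.log (thetaC r (Φ.flow s z) x) - Real.log (rhoC r (Φ.flow s z) x) - f (rhoC r (Φ.flow s z) x)) b₁) *
        ⟪momC r (Φ.flow s z) x, Torus.gradient (fun y => θ s y * Real.smoothTransition ((τ₀ + Δ - s) / Δ)) x⟫_ℝ)) +
      ∫ x, rhoC r (Φ.flow 0 z) x * max a₁ (min (3 / 2 * Real.log (thetaC r (Φ.flow 0 z) x) - Real.log (rhoC r (Φ.flow 0 z) x) -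
        f (rhoC r (Φ.flow 0 z) x)) b₁) * (θ 0 x * Real.smoothTransition ((τ₀ + Δ - 0) / Δ)) ≤
      ηL + (tsh * (max |a₁| |b₁| * (Cθ * (C / Δ * ((tsh - Δ) / n))) * KE +
          (max |a₁| |b₁| * (Cθ * (C / Δ * ((tsh - Δ) / n)) + Cθ * (C / Δ ^ 2 * ((tsh - Δ) / n))) +
            max |a₁| |b₁| * (Cθ * (C / Δ * ((tsh - Δ) / n))) / 2)) +
        max |a₁| |b₁| * Cθ * (C / Δ * ((tsh - Δ) / n))) +
      (tsh * (max |a₁| |b₁| * ω * KE + (max |a₁| |b₁| * (ω + ω * (C / Δ)) + max |a₁| |b₁| * ω / 2)) + max |a₁| |b₁| * ω) := by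
  have hn0 : (0 : ℝ) < n := by exact_mod_cast hn
  have hL0 : 0 ≤ tsh - Δ := by linarith
  have hh0 : 0 ≤ (tsh - Δ) / n := div_nonneg hL0 hn0.le
  obtain ⟨g, hg1, hg2⟩ := exists_grid_index hL0 hn hτ₀
  have htg0 : 0 ≤ (g : ℝ) * ((tsh - Δ) / n) := by positivity
  have htg1 : (g : ℝ) * ((tsh - Δ) / n) ≤ tsh - Δ := hg1.trans hτ₀.2
  have hdiff : |τ₀ - (g : ℝ) * ((tsh - Δ) / n)| ≤ (tsh - Δ) / n := by rw [abs_of_nonneg (by linarith)]; linarith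
  have htsh : 0 ≤ tsh := by linarith
  have hC0 : 0 ≤ C := (abs_nonneg _).trans (hC1 0)
  have hke0 : 0 ≤ ke z := ke_nonneg z
  have hσ3 : 0 ≤ σ ^ 3 := pow_nonneg hσ.le 3
  have hγ : Measurable fun s => Φ.flow s z := (Φ.isTrajectory z hz).measurable_torus
  have hZb : ∀ (w : Phase N) (x : T3), |max a₁ (min (3 / 2 * Real.log (thetaC r w x) - Real.log (rhoC r w x) -
      (hsExcessFreeEnergy (min (rhoC r w x * σ ^ 3) η₁) + deriv hsExcessFreeEnergy η₁ * max (rhoC r w x * σ ^ 3 - η₁) 0)) b₁)|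
      ≤ max |a₁| |b₁| := fun w x => abs_clamp_le _ _ _
  have hZm0 : 0 ≤ max |a₁| |b₁| := le_max_of_le_left (abs_nonneg _)
  have mZ := measurable_clampL_orbit hγ hr hσ3 a₁ b₁ hFc
  have mZ0' := mZ.comp (measurable_const.prodMk measurable_id : Measurable fun x : T3 => ((0 : ℝ), x))
  simp only [Function.comp_def] at mZ0'
  have mZ0 : Measurable fun x : T3 => max a₁ (min (3 / 2 * Real.log (thetaC r (Φ.flow 0 z) x) - Real.log (rhoC r (Φ.flow 0 z) x) -
      (hsExcessFreeEnergy (min (rhoC r (Φ.flow 0 z) x * σ ^ 3) η₁) + deriv hsExcessFreeEnergy η₁ * max (rhoC r (Φ.flow 0 z) x * σ ^ 3 - η₁) 0)) b₁) :=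
    mZ0'
  have hcut1 : ∀ τ s, |Real.smoothTransition ((τ + Δ - s) / Δ)| ≤ 1 := fun τ s => by
    rw [abs_of_nonneg (cut_mem τ Δ s).1]; exact (cut_mem τ Δ s).2
  have hdcut : ∀ τ s, |deriv Real.smoothTransition ((τ + Δ - s) / Δ) * (-Δ⁻¹)| ≤ C / Δ := fun τ s => abs_dcut_le hC1 hΔ τ s
  have hcutL : ∀ s, |Real.smoothTransition ((τ₀ + Δ - s) / Δ) - Real.smoothTransition (((g : ℝ) * ((tsh - Δ) / n) + Δ - s) / Δ)|
      ≤ C / Δ * ((tsh - Δ) / n) := fun s =>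
    (abs_cut_sub_cut_le hC1 hΔ s _ _).trans (mul_le_mul_of_nonneg_left hdiff (div_nonneg hC0 hΔ.le))
  have hdcutL : ∀ s, |deriv Real.smoothTransition ((τ₀ + Δ - s) / Δ) * (-Δ⁻¹) -
      deriv Real.smoothTransition (((g : ℝ) * ((tsh - Δ) / n) + Δ - s) / Δ) * (-Δ⁻¹)| ≤ C / Δ ^ 2 * ((tsh - Δ) / n) := fun s =>
    (abs_dcut_sub_dcut_le hC2 hΔ s _ _).trans (mul_le_mul_of_nonneg_left hdiff (div_nonneg hC0 (sq_nonneg _)))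
  have ccut : ∀ τ, Continuous fun s : ℝ => Real.smoothTransition ((τ + Δ - s) / Δ) := fun τ => (contDiff_cut τ Δ (n := 1)).continuous
  have cdcut : ∀ τ, Continuous fun s : ℝ => deriv Real.smoothTransition ((τ + Δ - s) / Δ) * (-Δ⁻¹) := fun τ => by
    have hd : Continuous (deriv Real.smoothTransition) := (Real.smoothTransition.contDiff (n := 1)).continuous_deriv le_rfl
    exact (hd.comp ((continuous_const.sub continuous_id).div_const _)).mul continuous_const
  -- ### the classical factors on the strip `[0, tsh]` (unshifted and shifted)
  obtain ⟨cθ0, cθt0, -, cθx0⟩ := scalar_factors hθ le_rfl (by linarith : tsh + 0 < T)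
  simp only [add_zero] at cθ0 cθt0 cθx0
  obtain ⟨cθe, cθte, -, cθxe⟩ := scalar_factors hθ he.le hte
  have cW : ∀ τ, ContinuousOn (uncurry fun s x => Torus.timeDerivWithin (Ico 0 T) θ s x * Real.smoothTransition ((τ + Δ - s) / Δ) +
      θ s x * (deriv Real.smoothTransition ((τ + Δ - s) / Δ) * (-Δ⁻¹))) (Icc 0 tsh ×ˢ univ) := fun τ =>
    (cθt0.mul ((ccut τ).comp continuous_fst).continuousOn).add (cθ0.mul ((cdcut τ).comp continuous_fst).continuousOn)
  have cG : ∀ τ, ContinuousOn (uncurry fun s x => Real.smoothTransition ((τ + Δ - s) / Δ) • Torus.gradient (θ s) x)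
      (Icc 0 tsh ×ˢ univ) := fun τ => ((ccut τ).comp continuous_fst).continuousOn.smul cθx0
  have cWe : ContinuousOn (uncurry fun s x => Torus.timeDerivWithin (Ico 0 T) θ (s + e) x *
      Real.smoothTransition (((g : ℝ) * ((tsh - Δ) / n) + Δ - s) / Δ) +
      θ (s + e) x * (deriv Real.smoothTransition (((g : ℝ) * ((tsh - Δ) / n) + Δ - s) / Δ) * (-Δ⁻¹))) (Icc 0 tsh ×ˢ univ) :=
    (cθte.mul ((ccut _).comp continuous_fst).continuousOn).add (cθe.mul ((cdcut _).comp continuous_fst).continuousOn)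
  have cGe : ContinuousOn (uncurry fun s x => Real.smoothTransition (((g : ℝ) * ((tsh - Δ) / n) + Δ - s) / Δ) •
      Torus.gradient (θ (s + e)) x) (Icc 0 tsh ×ˢ univ) := ((ccut _).comp continuous_fst).continuousOn.smul cθxe
  have hI : ∀ s ∈ Icc 0 tsh, s ∈ Icc 0 (tsh + e) := fun s hs => ⟨hs.1, by linarith [hs.2, he.le]⟩
  have hIe : ∀ s ∈ Icc 0 tsh, s + e ∈ Icc 0 (tsh + e) := fun s hs => ⟨by linarith [hs.1, he.le], by linarith [hs.2]⟩
  have bW : ∀ τ, ∀ s ∈ Icc 0 tsh, ∀ x, |Torus.timeDerivWithin (Ico 0 T) θ s x * Real.smoothTransition ((τ + Δ - s) / Δ) +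
      θ s x * (deriv Real.smoothTransition ((τ + Δ - s) / Δ) * (-Δ⁻¹))| ≤ Cθ * 1 + Cθ * (C / Δ) := fun τ s hs x => by
    have h1 := hθt s (hI s hs) x; have h2 := hθb s (hI s hs) x; have h3 := hcut1 τ s; have h4 := hdcut τ s
    calc _ ≤ |Torus.timeDerivWithin (Ico 0 T) θ s x * Real.smoothTransition ((τ + Δ - s) / Δ)| +
        |θ s x * (deriv Real.smoothTransition ((τ + Δ - s) / Δ) * (-Δ⁻¹))| := abs_add_le _ _
      _ ≤ Cθ * 1 + Cθ * (C / Δ) := by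
        rw [abs_mul, abs_mul]
        exact add_le_add (mul_le_mul h1 h3 (abs_nonneg _) hCθ) (mul_le_mul h2 h4 (abs_nonneg _) hCθ)
  have bG : ∀ τ, ∀ s ∈ Icc 0 tsh, ∀ x, ‖Real.smoothTransition ((τ + Δ - s) / Δ) • Torus.gradient (θ s) x‖ ≤ Cθ := fun τ s hs x => by
    rw [norm_smul, Real.norm_eq_abs]
    calc _ ≤ 1 * Cθ := mul_le_mul (hcut1 τ s) (hθx s (hI s hs) x) (norm_nonneg _) zero_le_one
      _ = Cθ := one_mul _
  have bWe : ∀ s ∈ Icc 0 tsh, ∀ x, |Torus.timeDerivWithin (Ico 0 T) θ (s + e) x *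
      Real.smoothTransition (((g : ℝ) * ((tsh - Δ) / n) + Δ - s) / Δ) +
      θ (s + e) x * (deriv Real.smoothTransition (((g : ℝ) * ((tsh - Δ) / n) + Δ - s) / Δ) * (-Δ⁻¹))| ≤ Cθ * 1 + Cθ * (C / Δ) :=
    fun s hs x => by
    have h1 := hθt _ (hIe s hs) x; have h2 := hθb _ (hIe s hs) x; have h3 := hcut1 ((g : ℝ) * ((tsh - Δ) / n)) s
    have h4 := hdcut ((g : ℝ) * ((tsh - Δ) / n)) s
    calc _ ≤ |Torus.timeDerivWithin (Ico 0 T) θ (s + e) x * Real.smoothTransition (((g : ℝ) * ((tsh - Δ) / n) + Δ - s) / Δ)| +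
        |θ (s + e) x * (deriv Real.smoothTransition (((g : ℝ) * ((tsh - Δ) / n) + Δ - s) / Δ) * (-Δ⁻¹))| := abs_add_le _ _
      _ ≤ Cθ * 1 + Cθ * (C / Δ) := by
        rw [abs_mul, abs_mul]
        exact add_le_add (mul_le_mul h1 h3 (abs_nonneg _) hCθ) (mul_le_mul h2 h4 (abs_nonneg _) hCθ)
  have bGe : ∀ s ∈ Icc 0 tsh, ∀ x, ‖Real.smoothTransition (((g : ℝ) * ((tsh - Δ) / n) + Δ - s) / Δ) •
      Torus.gradient (θ (s + e)) x‖ ≤ Cθ := fun s hs x => by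
    rw [norm_smul, Real.norm_eq_abs]
    calc _ ≤ 1 * Cθ := mul_le_mul (hcut1 _ s) (hθx _ (hIe s hs) x) (norm_nonneg _) zero_le_one
      _ = Cθ := one_mul _
  have dW : ∀ s ∈ Icc 0 tsh, ∀ x, |(Torus.timeDerivWithin (Ico 0 T) θ s x * Real.smoothTransition ((τ₀ + Δ - s) / Δ) +
      θ s x * (deriv Real.smoothTransition ((τ₀ + Δ - s) / Δ) * (-Δ⁻¹))) -
      (Torus.timeDerivWithin (Ico 0 T) θ s x * Real.smoothTransition (((g : ℝ) * ((tsh - Δ) / n) + Δ - s) / Δ) +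
      θ s x * (deriv Real.smoothTransition (((g : ℝ) * ((tsh - Δ) / n) + Δ - s) / Δ) * (-Δ⁻¹)))| ≤
      Cθ * (C / Δ * ((tsh - Δ) / n)) + Cθ * (C / Δ ^ 2 * ((tsh - Δ) / n)) := fun s hs x => by
    have h1 := hθt s (hI s hs) x; have h2 := hθb s (hI s hs) x; have h3 := hcutL s; have h4 := hdcutL s
    have e1 : ∀ {A B c c' d d' : ℝ}, A * c + B * d - (A * c' + B * d') = A * (c - c') + B * (d - d') := fun {A B c c' d d'} => by ring
    rw [e1]
    calc _ ≤ |Torus.timeDerivWithin (Ico 0 T) θ s x * _| + |θ s x * _| := abs_add_le _ _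
      _ ≤ Cθ * (C / Δ * ((tsh - Δ) / n)) + Cθ * (C / Δ ^ 2 * ((tsh - Δ) / n)) := by
        rw [abs_mul, abs_mul]
        exact add_le_add (mul_le_mul h1 h3 (abs_nonneg _) hCθ) (mul_le_mul h2 h4 (abs_nonneg _) hCθ)
  have dG : ∀ s ∈ Icc 0 tsh, ∀ x, ‖Real.smoothTransition ((τ₀ + Δ - s) / Δ) • Torus.gradient (θ s) x -
      Real.smoothTransition (((g : ℝ) * ((tsh - Δ) / n) + Δ - s) / Δ) • Torus.gradient (θ s) x‖ ≤ Cθ * (C / Δ * ((tsh - Δ) / n)) :=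
    fun s hs x => by
    rw [← sub_smul, norm_smul, Real.norm_eq_abs, mul_comm]
    exact mul_le_mul (hθx s (hI s hs) x) (hcutL s) (abs_nonneg _) hCθ
  have dWe : ∀ s ∈ Icc 0 tsh, ∀ x, |(Torus.timeDerivWithin (Ico 0 T) θ s x * Real.smoothTransition (((g : ℝ) * ((tsh - Δ) / n) + Δ - s) / Δ) +
      θ s x * (deriv Real.smoothTransition (((g : ℝ) * ((tsh - Δ) / n) + Δ - s) / Δ) * (-Δ⁻¹))) -
      (Torus.timeDerivWithin (Ico 0 T) θ (s + e) x * Real.smoothTransition (((g : ℝ) * ((tsh - Δ) / n) + Δ - s) / Δ) +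
      θ (s + e) x * (deriv Real.smoothTransition (((g : ℝ) * ((tsh - Δ) / n) + Δ - s) / Δ) * (-Δ⁻¹)))| ≤ ω + ω * (C / Δ) :=
    fun s hs x => by
    have h1 := hωt s hs x; have h2 := hωθ s hs x; have h3 := hcut1 ((g : ℝ) * ((tsh - Δ) / n)) s
    have h4 := hdcut ((g : ℝ) * ((tsh - Δ) / n)) s
    have e1 : ∀ {A A' B B' c d : ℝ}, A * c + B * d - (A' * c + B' * d) = (A - A') * c + (B - B') * d := fun {A A' B B' c d} => by ring
    rw [e1]
    calc _ ≤ |(Torus.timeDerivWithin (Ico 0 T) θ s x - Torus.timeDerivWithin (Ico 0 T) θ (s + e) x) * _| +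
        |(θ s x - θ (s + e) x) * _| := abs_add_le _ _
      _ ≤ ω * 1 + ω * (C / Δ) := by
        rw [abs_mul, abs_mul, abs_sub_comm (Torus.timeDerivWithin (Ico 0 T) θ s x), abs_sub_comm (θ s x)]
        exact add_le_add (mul_le_mul h1 h3 (abs_nonneg _) hω) (mul_le_mul h2 h4 (abs_nonneg _) hω)
      _ = ω + ω * (C / Δ) := by ring
  have dGe : ∀ s ∈ Icc 0 tsh, ∀ x, ‖Real.smoothTransition (((g : ℝ) * ((tsh - Δ) / n) + Δ - s) / Δ) • Torus.gradient (θ s) x -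
      Real.smoothTransition (((g : ℝ) * ((tsh - Δ) / n) + Δ - s) / Δ) • Torus.gradient (θ (s + e)) x‖ ≤ ω := fun s hs x => by
    rw [← smul_sub, norm_smul, Real.norm_eq_abs, norm_sub_rev]
    calc _ ≤ 1 * ω := mul_le_mul (hcut1 _ s) (hωx s hs x) (norm_nonneg _) zero_le_one
      _ = ω := one_mul _
  have hLip := entropy_sub hσ.le Φ hz hr hr2 htsh (a₁ := a₁) (b₁ := b₁) hFc (cW τ₀) (cG τ₀) (cW _) (cG _)
    (bW τ₀) (bG τ₀) (bW _) (bG _) dW dG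
  have hSh := entropy_sub hσ.le Φ hz hr hr2 htsh (a₁ := a₁) (b₁ := b₁) hFc (cW ((g : ℝ) * ((tsh - Δ) / n))) (cG _) cWe cGe
    (bW _) (bG _) bWe bGe dWe dGe
  simp only [sub_zero, zero_add] at hLip hSh
  -- ### the initial terms
  have hρ0 : Continuous (rhoC r (Φ.flow 0 z)) := continuous_rhoC r _
  have hθ0c : Continuous (θ 0) := (hθ.isSmooth_slice ⟨le_rfl, by linarith⟩).continuous
  have hθec : Continuous (θ (0 + e)) := (hθ.isSmooth_slice ⟨by linarith, by linarith⟩).continuous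
  have hT0L : |(∫ x, rhoC r (Φ.flow 0 z) x * max a₁ (min (3 / 2 * Real.log (thetaC r (Φ.flow 0 z) x) - Real.log (rhoC r (Φ.flow 0 z) x) -
      (hsExcessFreeEnergy (min (rhoC r (Φ.flow 0 z) x * σ ^ 3) η₁) + deriv hsExcessFreeEnergy η₁ * max (rhoC r (Φ.flow 0 z) x * σ ^ 3 - η₁) 0)) b₁) *
        (θ 0 x * Real.smoothTransition ((τ₀ + Δ - 0) / Δ))) -
      ∫ x, rhoC r (Φ.flow 0 z) x * max a₁ (min (3 / 2 * Real.log (thetaC r (Φ.flow 0 z) x) - Real.log (rhoC r (Φ.flow 0 z) x) -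
      (hsExcessFreeEnergy (min (rhoC r (Φ.flow 0 z) x * σ ^ 3) η₁) + deriv hsExcessFreeEnergy η₁ * max (rhoC r (Φ.flow 0 z) x * σ ^ 3 - η₁) 0)) b₁) *
        (θ 0 x * Real.smoothTransition (((g : ℝ) * ((tsh - Δ) / n) + Δ - 0) / Δ))| ≤ max |a₁| |b₁| * (Cθ * (C / Δ * ((tsh - Δ) / n))) := by
    have h := abs_integral_rho_weight_le hr hr2 (Φ.flow 0 z) (fun x => hZb (Φ.flow 0 z) x) (G := Cθ * (C / Δ * ((tsh - Δ) / n)))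
      (g := fun x => θ 0 x * (Real.smoothTransition ((τ₀ + Δ - 0) / Δ) - Real.smoothTransition (((g : ℝ) * ((tsh - Δ) / n) + Δ - 0) / Δ)))
      (fun x => by rw [abs_mul]; exact mul_le_mul (hθb 0 ⟨le_rfl, by linarith⟩ x) (hcutL 0) (abs_nonneg _) hCθ)
    refine le_trans (le_of_eq ?_) h
    have hb1 : ∀ c : ℝ, Integrable (fun x => rhoC r (Φ.flow 0 z) x * max a₁ (min (3 / 2 * Real.log (thetaC r (Φ.flow 0 z) x) -
        Real.log (rhoC r (Φ.flow 0 z) x) - (hsExcessFreeEnergy (min (rhoC r (Φ.flow 0 z) x * σ ^ 3) η₁) +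
        deriv hsExcessFreeEnergy η₁ * max (rhoC r (Φ.flow 0 z) x * σ ^ 3 - η₁) 0)) b₁) * (θ 0 x * c)) volume := fun c => by
      refine Integrable.mono' (integrable_const (3 / (Real.pi * r ^ 3) * max |a₁| |b₁| * (Cθ * |c|)))
        ((hρ0.measurable.mul mZ0).mul (hθ0c.measurable.mul measurable_const)).aestronglyMeasurable (ae_of_all _ fun x => ?_)
      rw [Real.norm_eq_abs, abs_mul, abs_mul, abs_mul, abs_of_nonneg (rhoC_nonneg hr _ _)]
      have := rhoC_le hr (Φ.flow 0 z) x; have := hZb (Φ.flow 0 z) x; have := hθb 0 ⟨le_rfl, by linarith⟩ x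
      have := rhoC_nonneg hr (Φ.flow 0 z) x
      gcongr
    rw [← integral_sub (hb1 _) (hb1 _)]
    congr 1
    exact integral_congr_ae (ae_of_all _ fun x => by ring)
  have hT0S : |(∫ x, rhoC r (Φ.flow 0 z) x * max a₁ (min (3 / 2 * Real.log (thetaC r (Φ.flow 0 z) x) - Real.log (rhoC r (Φ.flow 0 z) x) -
      (hsExcessFreeEnergy (min (rhoC r (Φ.flow 0 z) x * σ ^ 3) η₁) + deriv hsExcessFreeEnergy η₁ * max (rhoC r (Φ.flow 0 z) x * σ ^ 3 - η₁) 0)) b₁) *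
        (θ 0 x * Real.smoothTransition (((g : ℝ) * ((tsh - Δ) / n) + Δ - 0) / Δ))) -
      ∫ x, rhoC r (Φ.flow 0 z) x * max a₁ (min (3 / 2 * Real.log (thetaC r (Φ.flow 0 z) x) - Real.log (rhoC r (Φ.flow 0 z) x) -
      (hsExcessFreeEnergy (min (rhoC r (Φ.flow 0 z) x * σ ^ 3) η₁) + deriv hsExcessFreeEnergy η₁ * max (rhoC r (Φ.flow 0 z) x * σ ^ 3 - η₁) 0)) b₁) *
        (θ (0 + e) x * Real.smoothTransition (((g : ℝ) * ((tsh - Δ) / n) + Δ - 0) / Δ))| ≤ max |a₁| |b₁| * ω := by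
    have h := abs_integral_rho_weight_le hr hr2 (Φ.flow 0 z) (fun x => hZb (Φ.flow 0 z) x) (G := ω)
      (g := fun x => (θ 0 x - θ (0 + e) x) * Real.smoothTransition (((g : ℝ) * ((tsh - Δ) / n) + Δ - 0) / Δ))
      (fun x => by
        rw [abs_mul, abs_sub_comm]
        calc _ ≤ ω * 1 := mul_le_mul (hωθ 0 ⟨le_rfl, htsh⟩ x) (hcut1 _ 0) (abs_nonneg _) hω
          _ = ω := mul_one _)
    refine le_trans (le_of_eq ?_) h
    have hb1 : ∀ {v : T3 → ℝ}, Continuous v → (∀ x, |v x| ≤ Cθ) → Integrable (fun x => rhoC r (Φ.flow 0 z) x *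
        max a₁ (min (3 / 2 * Real.log (thetaC r (Φ.flow 0 z) x) -
        Real.log (rhoC r (Φ.flow 0 z) x) - (hsExcessFreeEnergy (min (rhoC r (Φ.flow 0 z) x * σ ^ 3) η₁) +
        deriv hsExcessFreeEnergy η₁ * max (rhoC r (Φ.flow 0 z) x * σ ^ 3 - η₁) 0)) b₁) *
        (v x * Real.smoothTransition (((g : ℝ) * ((tsh - Δ) / n) + Δ - 0) / Δ))) volume := fun {v} hv hvb => by
      refine Integrable.mono' (integrable_const (3 / (Real.pi * r ^ 3) * max |a₁| |b₁| * (Cθ * 1)))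
        ((hρ0.measurable.mul mZ0).mul (hv.measurable.mul measurable_const)).aestronglyMeasurable (ae_of_all _ fun x => ?_)
      rw [Real.norm_eq_abs, abs_mul, abs_mul, abs_mul, abs_of_nonneg (rhoC_nonneg hr _ _)]
      have := rhoC_le hr (Φ.flow 0 z) x; have := hZb (Φ.flow 0 z) x; have := hvb x; have := hcut1 ((g : ℝ) * ((tsh - Δ) / n)) 0
      have := rhoC_nonneg hr (Φ.flow 0 z) x
      gcongr
    rw [← integral_sub (hb1 hθ0c fun x => hθb 0 ⟨le_rfl, by linarith⟩ x) (hb1 hθec fun x => hθb _ ⟨by linarith, by linarith⟩ x)]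
    congr 1
    exact integral_congr_ae (ae_of_all _ fun x => by ring)
  -- ### conversion 1: the shell's functional in terms of the clamped-law weight and the data `qW τ₀, qG τ₀`
  have hconv1 : (∫ s in Icc 0 tsh, ∫ x,
      (rhoC r (Φ.flow s z) x * max a₁ (min (3 / 2 * Real.log (thetaC r (Φ.flow s z) x) - Real.log (rhoC r (Φ.flow s z) x) -
        f (rhoC r (Φ.flow s z) x)) b₁) *
        Torus.timeDerivWithin (Ico 0 T) (fun s' y => θ s' y * Real.smoothTransition ((τ₀ + Δ - s') / Δ)) s x +
      max a₁ (min (3 / 2 * Real.log (thetaC r (Φ.flow s z) x) - Real.log (rhoC r (Φ.flow s z) x) - f (rhoC r (Φ.flow s z) x)) b₁) *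
        ⟪momC r (Φ.flow s z) x, Torus.gradient (fun y => θ s y * Real.smoothTransition ((τ₀ + Δ - s) / Δ)) x⟫_ℝ)) +
      ∫ x, rhoC r (Φ.flow 0 z) x * max a₁ (min (3 / 2 * Real.log (thetaC r (Φ.flow 0 z) x) - Real.log (rhoC r (Φ.flow 0 z) x) -
        f (rhoC r (Φ.flow 0 z) x)) b₁) * (θ 0 x * Real.smoothTransition ((τ₀ + Δ - 0) / Δ)) =
      (∫ s in Icc 0 tsh, ∫ x,
      (rhoC r (Φ.flow s z) x * max a₁ (min (3 / 2 * Real.log (thetaC r (Φ.flow s z) x) - Real.log (rhoC r (Φ.flow s z) x) -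
        (hsExcessFreeEnergy (min (rhoC r (Φ.flow s z) x * σ ^ 3) η₁) + deriv hsExcessFreeEnergy η₁ * max (rhoC r (Φ.flow s z) x * σ ^ 3 - η₁) 0)) b₁) *
        (Torus.timeDerivWithin (Ico 0 T) θ s x * Real.smoothTransition ((τ₀ + Δ - s) / Δ) +
          θ s x * (deriv Real.smoothTransition ((τ₀ + Δ - s) / Δ) * (-Δ⁻¹))) +
      max a₁ (min (3 / 2 * Real.log (thetaC r (Φ.flow s z) x) - Real.log (rhoC r (Φ.flow s z) x) -
        (hsExcessFreeEnergy (min (rhoC r (Φ.flow s z) x * σ ^ 3) η₁) + deriv hsExcessFreeEnergy η₁ * max (rhoC r (Φ.flow s z) x * σ ^ 3 - η₁) 0)) b₁) *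
        ⟪momC r (Φ.flow s z) x, Real.smoothTransition ((τ₀ + Δ - s) / Δ) • Torus.gradient (θ s) x⟫_ℝ)) +
      ∫ x, rhoC r (Φ.flow 0 z) x * max a₁ (min (3 / 2 * Real.log (thetaC r (Φ.flow 0 z) x) - Real.log (rhoC r (Φ.flow 0 z) x) -
        (hsExcessFreeEnergy (min (rhoC r (Φ.flow 0 z) x * σ ^ 3) η₁) + deriv hsExcessFreeEnergy η₁ * max (rhoC r (Φ.flow 0 z) x * σ ^ 3 - η₁) 0)) b₁) *
        (θ 0 x * Real.smoothTransition ((τ₀ + Δ - 0) / Δ)) := by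
    congr 1
    · refine setIntegral_congr_fun measurableSet_Icc fun s hs => integral_congr_ae (ae_of_all _ fun x => ?_)
      have hsT : s ∈ Ico 0 T := ⟨hs.1, by linarith [hs.2]⟩
      beta_reduce
      rw [timeDerivWithin_test hθ τ₀ Δ hsT x, gradient_test hθ _ hsT x, rho_mul_clampSh_eq hr _ x hfband (hcap s hs x),
        clampSh_mul_inner_eq hr _ x hfband (hcap s hs x)]
    · refine integral_congr_ae (ae_of_all _ fun x => ?_)
      beta_reduce
      rw [rho_mul_clampSh_eq hr _ x hfband (hcap 0 ⟨le_rfl, htsh⟩ x)]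
  -- ### conversion 2: the clamped local second law functional at the grid start
  have hτgT : ∀ s ∈ Icc 0 tsh, s + e < T := fun s hs => by linarith [hs.2]
  have hconv2 : (∫ s in Icc 0 τL, ∫ x,
      (rhoC r (Φ.flow s z) x * max a₁ (min (3 / 2 * Real.log (thetaC r (Φ.flow s z) x) - Real.log (rhoC r (Φ.flow s z) x) -
        (hsExcessFreeEnergy (min (rhoC r (Φ.flow s z) x * σ ^ 3) η₁) +
          deriv hsExcessFreeEnergy η₁ * max (rhoC r (Φ.flow s z) x * σ ^ 3 - η₁) 0)) b₁) *
        Torus.timeDeriv (fun s' y => Real.smoothTransition ((s' + e / 2) / (e / 4)) * θ (s' + e) y *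
          Real.smoothTransition (((g : ℝ) * ((tsh - Δ) / n) + Δ - s') / Δ)) s x +
      max a₁ (min (3 / 2 * Real.log (thetaC r (Φ.flow s z) x) - Real.log (rhoC r (Φ.flow s z) x) -
        (hsExcessFreeEnergy (min (rhoC r (Φ.flow s z) x * σ ^ 3) η₁) +
          deriv hsExcessFreeEnergy η₁ * max (rhoC r (Φ.flow s z) x * σ ^ 3 - η₁) 0)) b₁) *
        ⟪momC r (Φ.flow s z) x, Torus.gradient (fun y => Real.smoothTransition ((s + e / 2) / (e / 4)) * θ (s + e) y *
          Real.smoothTransition (((g : ℝ) * ((tsh - Δ) / n) + Δ - s) / Δ)) x⟫_ℝ)) +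
      ∫ x, rhoC r (Φ.flow 0 z) x * max a₁ (min (3 / 2 * Real.log (thetaC r (Φ.flow 0 z) x) - Real.log (rhoC r (Φ.flow 0 z) x) -
        (hsExcessFreeEnergy (min (rhoC r (Φ.flow 0 z) x * σ ^ 3) η₁) +
          deriv hsExcessFreeEnergy η₁ * max (rhoC r (Φ.flow 0 z) x * σ ^ 3 - η₁) 0)) b₁) *
        (Real.smoothTransition (((0 : ℝ) + e / 2) / (e / 4)) * θ (0 + e) x *
          Real.smoothTransition (((g : ℝ) * ((tsh - Δ) / n) + Δ - 0) / Δ)) =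
      (∫ s in Icc 0 tsh, ∫ x,
      (rhoC r (Φ.flow s z) x * max a₁ (min (3 / 2 * Real.log (thetaC r (Φ.flow s z) x) - Real.log (rhoC r (Φ.flow s z) x) -
        (hsExcessFreeEnergy (min (rhoC r (Φ.flow s z) x * σ ^ 3) η₁) + deriv hsExcessFreeEnergy η₁ * max (rhoC r (Φ.flow s z) x * σ ^ 3 - η₁) 0)) b₁) *
        (Torus.timeDerivWithin (Ico 0 T) θ (s + e) x * Real.smoothTransition (((g : ℝ) * ((tsh - Δ) / n) + Δ - s) / Δ) +
          θ (s + e) x * (deriv Real.smoothTransition (((g : ℝ) * ((tsh - Δ) / n) + Δ - s) / Δ) * (-Δ⁻¹))) +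
      max a₁ (min (3 / 2 * Real.log (thetaC r (Φ.flow s z) x) - Real.log (rhoC r (Φ.flow s z) x) -
        (hsExcessFreeEnergy (min (rhoC r (Φ.flow s z) x * σ ^ 3) η₁) + deriv hsExcessFreeEnergy η₁ * max (rhoC r (Φ.flow s z) x * σ ^ 3 - η₁) 0)) b₁) *
        ⟪momC r (Φ.flow s z) x, Real.smoothTransition (((g : ℝ) * ((tsh - Δ) / n) + Δ - s) / Δ) • Torus.gradient (θ (s + e)) x⟫_ℝ)) +
      ∫ x, rhoC r (Φ.flow 0 z) x * max a₁ (min (3 / 2 * Real.log (thetaC r (Φ.flow 0 z) x) - Real.log (rhoC r (Φ.flow 0 z) x) -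
        (hsExcessFreeEnergy (min (rhoC r (Φ.flow 0 z) x * σ ^ 3) η₁) + deriv hsExcessFreeEnergy η₁ * max (rhoC r (Φ.flow 0 z) x * σ ^ 3 - η₁) 0)) b₁) *
        (θ (0 + e) x * Real.smoothTransition (((g : ℝ) * ((tsh - Δ) / n) + Δ - 0) / Δ)) := by
    congr 1
    · rw [setIntegral_eq_of_subset_of_forall_sdiff_eq_zero measurableSet_Icc (Icc_subset_Icc_right htL)]
      · refine setIntegral_congr_fun measurableSet_Icc fun s hs => integral_congr_ae (ae_of_all _ fun x => ?_)
        beta_reduce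
        rw [entropyTest_timeDeriv hθ he hs.1 (hτgT s hs) x, entropyTest_gradient hθ he hs.1 (hτgT s hs) x]
      · intro s hs
        have hs' : (g : ℝ) * ((tsh - Δ) / n) + Δ < s := by
          have h1 : ¬ s ≤ tsh := fun h => hs.2 ⟨hs.1.1, h⟩
          push Not at h1; linarith
        have hd := entropyTest_derivs_zero (θ := θ) (e := e) hΔ hs'
        have hzero : ∀ x, rhoC r (Φ.flow s z) x * max a₁ (min (3 / 2 * Real.log (thetaC r (Φ.flow s z) x) - Real.log (rhoC r (Φ.flow s z) x) -
            (hsExcessFreeEnergy (min (rhoC r (Φ.flow s z) x * σ ^ 3) η₁) +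
              deriv hsExcessFreeEnergy η₁ * max (rhoC r (Φ.flow s z) x * σ ^ 3 - η₁) 0)) b₁) *
            Torus.timeDeriv (fun s' y => Real.smoothTransition ((s' + e / 2) / (e / 4)) * θ (s' + e) y *
              Real.smoothTransition (((g : ℝ) * ((tsh - Δ) / n) + Δ - s') / Δ)) s x +
          max a₁ (min (3 / 2 * Real.log (thetaC r (Φ.flow s z) x) - Real.log (rhoC r (Φ.flow s z) x) -
            (hsExcessFreeEnergy (min (rhoC r (Φ.flow s z) x * σ ^ 3) η₁) +
              deriv hsExcessFreeEnergy η₁ * max (rhoC r (Φ.flow s z) x * σ ^ 3 - η₁) 0)) b₁) *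
            ⟪momC r (Φ.flow s z) x, Torus.gradient (fun y => Real.smoothTransition ((s + e / 2) / (e / 4)) * θ (s + e) y *
              Real.smoothTransition (((g : ℝ) * ((tsh - Δ) / n) + Δ - s) / Δ)) x⟫_ℝ = 0 := fun x => by
          rw [(hd x).1, (hd x).2, inner_zero_right, mul_zero, mul_zero, add_zero]
        simp_rw [hzero, integral_zero]
    · refine integral_congr_ae (ae_of_all _ fun x => ?_)
      beta_reduce
      rw [entropyTest_zero (θ := θ) (Δ := Δ) he x]
  -- ### bookkeeping
  have hLg' := hLg g
  rw [hconv2] at hLg'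
  rw [hconv1]
  have h1 := (abs_le.1 hLip).2
  have h2 := (abs_le.1 hT0L).2
  have h3 := (abs_le.1 hSh).2
  have h4 := (abs_le.1 hT0S).2
  have hm1 : tsh * (max |a₁| |b₁| * (Cθ * (C / Δ * ((tsh - Δ) / n))) * ke z +
      (max |a₁| |b₁| * (Cθ * (C / Δ * ((tsh - Δ) / n)) + Cθ * (C / Δ ^ 2 * ((tsh - Δ) / n))) +
        max |a₁| |b₁| * (Cθ * (C / Δ * ((tsh - Δ) / n))) / 2)) ≤
      tsh * (max |a₁| |b₁| * (Cθ * (C / Δ * ((tsh - Δ) / n))) * KE +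
      (max |a₁| |b₁| * (Cθ * (C / Δ * ((tsh - Δ) / n)) + Cθ * (C / Δ ^ 2 * ((tsh - Δ) / n))) +
        max |a₁| |b₁| * (Cθ * (C / Δ * ((tsh - Δ) / n))) / 2)) := by
    have hx1 : max |a₁| |b₁| * (Cθ * (C / Δ * ((tsh - Δ) / n))) * ke z ≤ max |a₁| |b₁| * (Cθ * (C / Δ * ((tsh - Δ) / n))) * KE :=
      mul_le_mul_of_nonneg_left hKE (by positivity)
    have := mul_le_mul_of_nonneg_left (sub_nonneg.2 hx1) htsh
    linarith
  have hm2 : tsh * (max |a₁| |b₁| * ω * ke z + (max |a₁| |b₁| * (ω + ω * (C / Δ)) + max |a₁| |b₁| * ω / 2)) ≤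
      tsh * (max |a₁| |b₁| * ω * KE + (max |a₁| |b₁| * (ω + ω * (C / Δ)) + max |a₁| |b₁| * ω / 2)) := by
    have hx1 : max |a₁| |b₁| * ω * ke z ≤ max |a₁| |b₁| * ω * KE := mul_le_mul_of_nonneg_left hKE (by positivity)
    have := mul_le_mul_of_nonneg_left (sub_nonneg.2 hx1) htsh
    linarith
  linarith

end Summit.AtomisticToContinuum.HydrodynamicLimit.Theorems.ChaosClosesEulerReduction

end
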